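import Summits.MatrixMultiplication.OmegaCensus.SmallFormats.InvertiblePointNearFrame
import Mathlib.LinearAlgebra.Dual.Lemmas
import HarnessLib

/-!
# ω-census family (a): the ω-LAW at a near-frame point of `⟨m,m,n⟩` (kernel form of the desk law Pa27)

Cell `pub-omega` (unit `pub-omega-eng1-g28`, ENG1 = exact engine #1 of the cell), topic
`Summits/MatrixMultiplication/OmegaCensus` (sub-folder `SmallFormats`). Framing (verbatim): lottery ticket; floor =
certified bounds/negative ranges. HONEST FRAMING: a one-line consequence of the kernel near-frame reduction
`nearBasis_footprint_eq` (`InvertiblePointNearFrame`, tensor g25, p493611), over an arbitrary field and for every `m, n`: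
the identity that BOTH ω-branching near-stage engines of the `𝔽₃` `⟨2,2,6⟩ @ 20` census use as their branch law
(tensor `nearomega`, `OMEGA-LAW.md` §3; ENG1 `omega5`, `OMEGA-LAW-ENG1-DERIVATION.md`; booked as the DESK law Pa27,
derived ×2), together with the completeness statement that makes the ω-branching a sound necessary-condition filter.
It is not a rank bound and says nothing on `ω` the exponent; `ω` below is a linear functional on `k^{m×n}`.

**Setting** (as in `InvertiblePointNearFrame`, point moved to `X₀ = 1`): `β` computes `X ↦ XY`, `O` = the terms with
`f_i(1) ≠ 0`, `c_s := f_s/f_s(1)`, `Z := Oᶜ`, `ρ, σ` the near-frame data (`f_s(1) g_s(W_j) = δ_{sj} + ρ_s σ_j`,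
`exists_nearFrame`), `j₀ ∈ O` the removed term, `σ_j = l·σ_{j₀}`, `W'_j := W_j − l W_{j₀}` a reduced basis vector.
* (`omega_law`) for every linear functional `ω` on `k^{m×n}` with `ω(W_t) = 0` for all `t ∈ Z` with `f_t(X) ≠ 0`:
  `ω(X·W'_j) − c_j(X)·ω(W'_j) = ω(W_{j₀}) · l · (c_j(X) − c_{j₀}(X))` — apply `ω` to `nearBasis_footprint_eq`; the
  `Z`-sum dies. With `κ := ω(W_{j₀})`, ONE scalar common to all `j`, the functional `X ↦ ω((X − c_j(X))W'_j)` is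
  `κ·l·(c_j − c_{j₀})` (Pa27 (a): 'proportional to `c_j − c_{j₀}`', two linear conditions per candidate);
  (`omega_law_of_sigma_eq_zero`, Pa27 (b)) it VANISHES when `σ_j = 0` (`W'_j = W_j`); (`omega_law_of_kappa_eq_zero`,
  Pa27 (c)) ALL of them vanish in the sub-branch `κ = 0`; (`omega_law_of_forall`) the form with the global hypothesis
  `ω(W_t) = 0` for all `t ∈ Z` that the engines use; (`w_removed_eq_sum_nearBasis`, `kappa_eq_sum_nearBasis`, Pa27 (c)
  joint form) `W_{j₀} = σ_{j₀} Σ_{j≠j₀} ρ_j W'_j`, so `κ = σ_{j₀} Σ_{j≠j₀} ρ_j ω(W'_j)` is a FIXED linear combination of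
  the values of `ω` on the reduced basis.
* (`exists_dual_annihilating_of_finrank_lt`, completeness of the branching) if the `Z`-outputs lie in a subspace `P`
  (the 'type space' `𝒲_τ ⊇ span{W_t : t ∈ Z} + k·W_{j₀}` handed to the engines) and `dim span{W_t : t ∈ Z} < dim P`
  — automatic when `dim P > |ι| − |O| = |Z|` (`exists_dual_annihilating_of_card_lt`, via `finrank_span_w_compl_le`) —
  then SOME functional kills every `W_t` (`t ∈ Z`) and is not identically zero on `P`; by `omega_law` the true reduced
  basis of a genuine scheme satisfies the law for it (`exists_omega_branch`), i.e. it survives in at least one branch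
  `ω ∈ P(P^*)`. Hence 'every ω-branch of a (check, j₀, type) instance is empty' ⇒ 'no scheme realises that instance'.
What is NOT here: the enumeration of the type spaces (317 Kronecker types, engines ×2), the candidate lists `B_p(𝒲_τ)`,
any search, the `G`-side (obtained in the census from the `W`-side statements by the transpose duality already used for
(N1)–(N4)), and the no-go laws for particular ω-classes (tensor `NEAR-STRUCTURE.md` §6/§8, separate files).
Controls (outside Lean): ENG1 g27 `control5.py` R3 — on the tree's real `⟨2,2,3⟩@11` scheme mod 3, at all 36
(near point, side, `j₀`) cases exactly one annihilating `ω` exists up to scalars and the TRUE reduced basis satisfies the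
law (`κ ≠ 0` in 30 cases, `κ = 0` in 6); tensor g25 controls C1–C5, 72/72.
-/

namespace Summit.MatrixMultiplication.OmegaCensus.SmallFormats

open Module Matrix Literature.Computability.AlgebraicComplexity

variable {k : Type*} [Field k] {m n : ℕ} {ι : Type*} [Fintype ι]

section OmegaLaw

variable (β : BilinComp (mulBilin k m m n) ι) (O : Finset ι)

/-- **The ω-law (kernel form of the desk law Pa27 (a)).** At `X₀ = 1` with near-frame data `ρ, σ`
(`f_s(1) g_s(W_j) = δ_{sj} + ρ_s σ_j` on `O`), `j₀, j ∈ O`, `σ_j = l σ_{j₀}`: for every matrix `X` and every linear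
functional `ω` on `k^{m×n}` that vanishes on the outputs `W_t`, `t ∉ O`, with `f_t(X) ≠ 0`,
`ω(X·(W_j − l W_{j₀})) − c_j(X)·ω(W_j − l W_{j₀}) = ω(W_{j₀}) · l · (c_j(X) − c_{j₀}(X))`, `c_s := f_s/f_s(1)`.
Proof: apply `ω` to `nearBasis_footprint_eq`; the `Z`-sum is killed term by term. Any field, any `m, n`. -/
theorem omega_law [DecidableEq ι] (hO' : ∀ i ∈ O, β.f i 1 ≠ 0) {ρ σ : ι → k}
    (hM : ∀ s ∈ O, ∀ j ∈ O, β.f s 1 * β.g s (β.w j) = (if s = j then 1 else 0) + ρ s * σ j)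
    {j₀ : ι} (hj₀ : j₀ ∈ O) {j : ι} (hj : j ∈ O) {l : k} (hl : σ j = l * σ j₀) (X : Matrix (Fin m) (Fin m) k)
    (ω : Module.Dual k (Matrix (Fin m) (Fin n) k)) (hω : ∀ t, t ∉ O → β.f t X ≠ 0 → ω (β.w t) = 0) :
    ω (X * (β.w j - l • β.w j₀)) - (β.f j X * (β.f j 1)⁻¹) * ω (β.w j - l • β.w j₀) =
      ω (β.w j₀) * (l * (β.f j X * (β.f j 1)⁻¹ - β.f j₀ X * (β.f j₀ 1)⁻¹)) := by
  have hz : ω (∑ t ∈ Finset.univ \ O, (β.f t X * β.g t (β.w j - l • β.w j₀)) • β.w t) = 0 := by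
    rw [map_sum]
    refine Finset.sum_eq_zero fun t ht => ?_
    rw [map_smul, smul_eq_mul]
    by_cases hft : β.f t X = 0
    · rw [hft, zero_mul, zero_mul]
    · rw [hω t (Finset.mem_sdiff.mp ht).2 hft, mul_zero]
  have key : ω (X * (β.w j - l • β.w j₀) - (β.f j X * (β.f j 1)⁻¹) • (β.w j - l • β.w j₀)) =
      ω ((l * (β.f j X * (β.f j 1)⁻¹ - β.f j₀ X * (β.f j₀ 1)⁻¹)) • β.w j₀) := by
    rw [nearBasis_footprint_eq β O hO' hM hj₀ hj hl X, map_add, hz, add_zero]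
  rw [map_sub, map_smul, map_smul] at key
  simp only [smul_eq_mul] at key
  rw [key]; ring

/-- **The ω-law, global hypothesis (the form both engines use).** Same identity for every functional `ω` vanishing on
ALL the outputs `W_t`, `t ∉ O` (i.e. on `𝒲' := span{W_t : t ∈ Z}`). -/
theorem omega_law_of_forall [DecidableEq ι] (hO' : ∀ i ∈ O, β.f i 1 ≠ 0) {ρ σ : ι → k}
    (hM : ∀ s ∈ O, ∀ j ∈ O, β.f s 1 * β.g s (β.w j) = (if s = j then 1 else 0) + ρ s * σ j)
    {j₀ : ι} (hj₀ : j₀ ∈ O) {j : ι} (hj : j ∈ O) {l : k} (hl : σ j = l * σ j₀) (X : Matrix (Fin m) (Fin m) k)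
    (ω : Module.Dual k (Matrix (Fin m) (Fin n) k)) (hω : ∀ t, t ∉ O → ω (β.w t) = 0) :
    ω (X * (β.w j - l • β.w j₀)) - (β.f j X * (β.f j 1)⁻¹) * ω (β.w j - l • β.w j₀) =
      ω (β.w j₀) * (l * (β.f j X * (β.f j 1)⁻¹ - β.f j₀ X * (β.f j₀ 1)⁻¹)) :=
  omega_law β O hO' hM hj₀ hj hl X ω fun t ht _ => hω t ht

/-- **Pa27 (b): a term with `σ_j = 0` is rigid.** If `σ_j = 0` (so `W'_j = W_j`, the term carries no defect) then the
functional vanishes identically: `ω(X·W_j) = c_j(X)·ω(W_j)` for every `X` — three linear conditions per candidate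
instead of two. -/
theorem omega_law_of_sigma_eq_zero [DecidableEq ι] (hO' : ∀ i ∈ O, β.f i 1 ≠ 0) {ρ σ : ι → k}
    (hM : ∀ s ∈ O, ∀ j ∈ O, β.f s 1 * β.g s (β.w j) = (if s = j then 1 else 0) + ρ s * σ j)
    {j₀ : ι} (hj₀ : j₀ ∈ O) {j : ι} (hj : j ∈ O) (hσ : σ j = 0) (X : Matrix (Fin m) (Fin m) k)
    (ω : Module.Dual k (Matrix (Fin m) (Fin n) k)) (hω : ∀ t, t ∉ O → β.f t X ≠ 0 → ω (β.w t) = 0) :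
    ω (X * β.w j) = (β.f j X * (β.f j 1)⁻¹) * ω (β.w j) := by
  have h := omega_law β O hO' hM hj₀ hj (l := 0) (by rw [hσ, zero_mul]) X ω hω
  simp only [zero_smul, sub_zero, zero_mul, mul_zero] at h
  exact sub_eq_zero.mp h

/-- **Pa27 (c): the sub-branch `κ = 0`.** If `κ := ω(W_{j₀}) = 0` then EVERY reduced functional vanishes:
`ω(X·W'_j) = c_j(X)·ω(W'_j)` for all `j ∈ O` and all `X`. -/
theorem omega_law_of_kappa_eq_zero [DecidableEq ι] (hO' : ∀ i ∈ O, β.f i 1 ≠ 0) {ρ σ : ι → k}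
    (hM : ∀ s ∈ O, ∀ j ∈ O, β.f s 1 * β.g s (β.w j) = (if s = j then 1 else 0) + ρ s * σ j)
    {j₀ : ι} (hj₀ : j₀ ∈ O) {j : ι} (hj : j ∈ O) {l : k} (hl : σ j = l * σ j₀) (X : Matrix (Fin m) (Fin m) k)
    (ω : Module.Dual k (Matrix (Fin m) (Fin n) k)) (hω : ∀ t, t ∉ O → β.f t X ≠ 0 → ω (β.w t) = 0)
    (hκ : ω (β.w j₀) = 0) :
    ω (X * (β.w j - l • β.w j₀)) = (β.f j X * (β.f j 1)⁻¹) * ω (β.w j - l • β.w j₀) := by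
  have h := omega_law β O hO' hM hj₀ hj hl X ω hω
  rw [hκ, zero_mul] at h
  exact sub_eq_zero.mp h

/-- **The removed output in the reduced basis.** With the full near-frame data (`Σ_{j∈O} ρ_j W_j = 0`,
`Σ_{s∈O} ρ_s σ_s = −1`, `σ_j = l_j σ_{j₀}` on `O`): `W_{j₀} = σ_{j₀} · Σ_{j ∈ O∖{j₀}} ρ_j (W_j − l_j W_{j₀})`.
(Split the relation `Σ ρ_j W_j = 0` along the reduced basis; the coefficient of `W_{j₀}` is `Σ_j ρ_j l_j = −1/σ_{j₀}`.) -/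
theorem w_removed_eq_sum_nearBasis [DecidableEq ι] {ρ σ l : ι → k}
    (hrel : ∑ j ∈ O, ρ j • β.w j = 0) (hρσ : ∑ s ∈ O, ρ s * σ s = -1)
    {j₀ : ι} (hj₀ : j₀ ∈ O) (hl : ∀ j ∈ O, σ j = l j * σ j₀) :
    β.w j₀ = σ j₀ • ∑ j ∈ O.erase j₀, ρ j • (β.w j - l j • β.w j₀) := by
  -- `σ_{j₀} ≠ 0` (else every `σ_j = 0` on `O` and `Σ ρ_s σ_s = 0 ≠ −1`), hence `l_{j₀} = 1`
  have hσ : σ j₀ ≠ 0 := by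
    intro h0
    have hz : ∑ s ∈ O, ρ s * σ s = 0 :=
      Finset.sum_eq_zero fun s hs => by rw [hl s hs, h0, mul_zero, mul_zero]
    rw [hz] at hρσ
    exact one_ne_zero (by linear_combination hρσ : (1 : k) = 0)
  have hl₀ : l j₀ = 1 := by
    have h := hl j₀ hj₀
    rcases mul_eq_zero.mp (show (l j₀ - 1) * σ j₀ = 0 by linear_combination -h) with h1 | h1
    · exact sub_eq_zero.mp h1
    · exact absurd h1 hσ
  have hsum_l : (∑ j ∈ O, ρ j * l j) * σ j₀ = -1 := by
    rw [Finset.sum_mul, ← hρσ]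
    exact Finset.sum_congr rfl fun j hj => by rw [hl j hj]; ring
  -- the relation `Σ ρ_j W_j = 0` split along the reduced basis
  have hsplit : ∑ j ∈ O.erase j₀, ρ j • (β.w j - l j • β.w j₀) + (∑ j ∈ O, ρ j * l j) • β.w j₀ = 0 := by
    rw [Finset.sum_erase O (f := fun j => ρ j • (β.w j - l j • β.w j₀))
      (by simp only [hl₀, one_smul, sub_self, smul_zero]), Finset.sum_smul, ← Finset.sum_add_distrib, ← hrel]
    exact Finset.sum_congr rfl fun j _ => by rw [smul_sub, smul_smul, sub_add_cancel]
  -- multiply by `σ_{j₀}` and use `(Σ ρ_j l_j)·σ_{j₀} = −1`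
  have h2 : σ j₀ • ∑ j ∈ O.erase j₀, ρ j • (β.w j - l j • β.w j₀) + (σ j₀ * ∑ j ∈ O, ρ j * l j) • β.w j₀ = 0 := by
    have h := congrArg (fun Y => σ j₀ • Y) hsplit
    simpa only [smul_add, smul_smul, smul_zero] using h
  rw [mul_comm (σ j₀) (∑ j ∈ O, ρ j * l j), hsum_l, neg_one_smul, ← sub_eq_add_neg, sub_eq_zero] at h2
  exact h2.symm

/-- **Pa27 (c), joint form: the common scalar.** Under the full near-frame data, for every linear functional `ω`:
`κ := ω(W_{j₀}) = σ_{j₀} · Σ_{j ∈ O∖{j₀}} ρ_j ω(W_j − l_j W_{j₀})` — the proportionality constants `κ·l_j` of all the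
reduced functionals are ONE scalar, itself a fixed linear combination of the values of `ω` on the reduced basis. -/
theorem kappa_eq_sum_nearBasis [DecidableEq ι] {ρ σ l : ι → k}
    (hrel : ∑ j ∈ O, ρ j • β.w j = 0) (hρσ : ∑ s ∈ O, ρ s * σ s = -1)
    {j₀ : ι} (hj₀ : j₀ ∈ O) (hl : ∀ j ∈ O, σ j = l j * σ j₀) (ω : Module.Dual k (Matrix (Fin m) (Fin n) k)) :
    ω (β.w j₀) = σ j₀ * ∑ j ∈ O.erase j₀, ρ j * ω (β.w j - l j • β.w j₀) := by
  conv_lhs => rw [w_removed_eq_sum_nearBasis β O hrel hρσ hj₀ hl]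
  simp only [map_smul, map_sum, smul_eq_mul]

end OmegaLaw

section Completeness

variable (β : BilinComp (mulBilin k m m n) ι) (O : Finset ι)

/-- **Existence of an annihilating branch functional.** If every output `W_t`, `t ∉ O`, lies in a subspace `P` of
`k^{m×n}` and `dim span{W_t : t ∉ O} < dim P`, then some linear functional on `k^{m×n}` kills every `W_t` (`t ∉ O`)
and is NOT identically zero on `P` (so its restriction to `P` is a point of `P(P^*)`, one of the engines' branches).
Proof: `span{W_t} < P` strictly; separate a vector of `P` outside the span by a functional
(`Submodule.exists_dual_map_eq_bot_of_notMem`). -/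
theorem exists_dual_annihilating_of_finrank_lt (P : Submodule k (Matrix (Fin m) (Fin n) k))
    (hZP : ∀ t, t ∉ O → β.w t ∈ P)
    (hlt : finrank k (Submodule.span k (β.w '' {t | t ∉ O})) < finrank k P) :
    ∃ ω : Module.Dual k (Matrix (Fin m) (Fin n) k), (∀ t, t ∉ O → ω (β.w t) = 0) ∧ ∃ p ∈ P, ω p ≠ 0 := by
  set S := Submodule.span k (β.w '' {t | t ∉ O}) with hS
  have hSP : S ≤ P := Submodule.span_le.mpr (by rintro _ ⟨t, ht, rfl⟩; exact hZP t ht)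
  have hne : S ≠ P := by
    intro h
    rw [h] at hlt
    exact lt_irrefl _ hlt
  obtain ⟨p, hpP, hpS⟩ : ∃ p ∈ P, p ∉ S := by
    by_contra hall
    push Not at hall
    exact hne (le_antisymm hSP hall)
  obtain ⟨ω, hωp, hωS⟩ := Submodule.exists_dual_map_eq_bot_of_notMem hpS inferInstance
  refine ⟨ω, fun t ht => ?_, p, hpP, hωp⟩
  have hmem : ω (β.w t) ∈ S.map ω := Submodule.mem_map_of_mem (Submodule.subset_span ⟨t, ht, rfl⟩)
  rw [hωS] at hmem
  exact (Submodule.mem_bot k).mp hmem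

/-- **Existence, counting form.** The dimension hypothesis of `exists_dual_annihilating_of_finrank_lt` holds as soon as
`dim P > |ι| − |O|` (`= |Z|`), because `dim span{W_t : t ∉ O} ≤ |ι| − |O|` (`finrank_span_w_compl_le`). In the
`⟨2,2,6⟩ @ 20` near census: `|Z| = 7 < 8 = dim 𝒲_τ`. -/
theorem exists_dual_annihilating_of_card_lt (P : Submodule k (Matrix (Fin m) (Fin n) k))
    (hZP : ∀ t, t ∉ O → β.w t ∈ P) (hcard : Fintype.card ι - O.card < finrank k P) :
    ∃ ω : Module.Dual k (Matrix (Fin m) (Fin n) k), (∀ t, t ∉ O → ω (β.w t) = 0) ∧ ∃ p ∈ P, ω p ≠ 0 :=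
  exists_dual_annihilating_of_finrank_lt β O P hZP ((finrank_span_w_compl_le β O).trans_lt hcard)

/-- **Soundness of the ω-branched near-stage filter (the statement both engines' branching rests on).** At `X₀ = 1`
with near-frame data `ρ, σ` and a removed term `j₀ ∈ O`, if the `Z`-outputs of a GENUINE computation lie in a
subspace `P` with `dim P > |ι| − |O|`, then there is a functional `ω`, nonzero on `P` and killing every `W_t`
(`t ∉ O`), for which EVERY reduced basis vector `W_j − l W_{j₀}` (`j ∈ O`, `σ_j = l σ_{j₀}`) obeys the ω-law at every
`X`. So a real scheme of the given type survives in at least one branch `ω ∈ P(P^*)`; equivalently, if every branch of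
an instance is empty the instance is realised by no scheme. -/
theorem exists_omega_branch [DecidableEq ι] (hO' : ∀ i ∈ O, β.f i 1 ≠ 0) {ρ σ : ι → k}
    (hM : ∀ s ∈ O, ∀ j ∈ O, β.f s 1 * β.g s (β.w j) = (if s = j then 1 else 0) + ρ s * σ j)
    {j₀ : ι} (hj₀ : j₀ ∈ O) (P : Submodule k (Matrix (Fin m) (Fin n) k))
    (hZP : ∀ t, t ∉ O → β.w t ∈ P) (hcard : Fintype.card ι - O.card < finrank k P) :
    ∃ ω : Module.Dual k (Matrix (Fin m) (Fin n) k), (∃ p ∈ P, ω p ≠ 0) ∧ (∀ t, t ∉ O → ω (β.w t) = 0) ∧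
      ∀ j ∈ O, ∀ l : k, σ j = l * σ j₀ → ∀ X : Matrix (Fin m) (Fin m) k,
        ω (X * (β.w j - l • β.w j₀)) - (β.f j X * (β.f j 1)⁻¹) * ω (β.w j - l • β.w j₀) =
          ω (β.w j₀) * (l * (β.f j X * (β.f j 1)⁻¹ - β.f j₀ X * (β.f j₀ 1)⁻¹)) := by
  obtain ⟨ω, hω, hP⟩ := exists_dual_annihilating_of_card_lt β O P hZP hcard
  exact ⟨ω, hP, hω, fun j hj l hl X => omega_law_of_forall β O hO' hM hj₀ hj hl X ω hω⟩

end Completeness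

end Summit.MatrixMultiplication.OmegaCensus.SmallFormats
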